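import Literature.Probability.FitznerVanDerHofstad2017.Stage1TabsD10
import Summits.CriticalPhenomena.LaceExpansionHighD.SawCountGN15X5zzx
import HarnessLib

/-!
# Link line for the `d := 10` what-if stage-1 table: `nrSAW v00001` at `n = 15` (retires one R823-rider entry)

Programme-side complement of `Literature/…/FitznerVanDerHofstad2017/Stage1TabsD10` §F (pattern of `SawCountD11LinkExt` /
`Stage1TabsD10LinkExt`): the kernel class theorem `card_sawWordsTo_n15_x5` (`SawCountGN15X5a–zzx`, machine `sawCodeG`,
40 049 572 kernel calls; fresh-direction coefficients `N_j = [0, 25966, 3726615, 15838270, 10258770, 1347489]`) evaluates at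
`d = 10` to `1 213 263 042 588` (`card_sawWordsTo_n15_x5_d10`) = the audited table entry `Stage1Cells.CertD10.sawRows .v00001`
at `j = 15`, which the typed Stage 1 READS at the what-if tuples `P = (10,18,36)` and `(10,18,40)` (`Stage1EvalD10` docstring
list of displayed entries, R823 rider).  After this module that entry is a tree theorem; the displayed-and-uncertified read
entries number 37 (of 347 read at `P = (10,18,36)`) and 53 (of 378 at `(10,18,40)`) — bookkeeping: seat enum1-g47's `COUNTS-D10`
erratum v1.1 + `FEASIBILITY-5C`.  What-if / input-certification lane: no `Inputs` record, no `…Of 10`, nothing here is a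
certificate of any mean-field statement; no facts, no hypotheses.
-/

namespace Summit.CriticalPhenomena.LaceExpansionHighD.TabsD10

open Literature.Probability.LatticeModels Literature.Probability.Percolation
open Literature.Probability.FitznerVanDerHofstad2017

/-- LINK: `nrSAW[15,10,v00001] = c_15(x_v00001; 10)` — the audited table entry `Stage1Cells.CertD10.sawRows .v00001` at
`j = 15` IS the walk count `#sawWordsTo 10 15 (5e₁) = 1213263042588` (read at `P = (10,18,36)` and `(10,18,40)`; previously displayed). -/
theorem sawRows_v00001_getD_15 :
    (Stage1Cells.CertD10.sawRows .v00001).getD 15 0 = ((sawWordsTo 10 15 (siteOfList [5] 10)).card : ℚ) := by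
  rw [card_sawWordsTo_n15_x5_d10]; norm_num [Stage1Cells.CertD10.sawRows]

/-- **nrSAW row at `v00001`, packaged:** `tabsHi.saw j v00001 = #sawWordsTo 10 j x_v00001` for every `0 ≤ j ≤ 16`
(`Stage1TabsD10` has the individual links `sawRows_v00001_getD_j` for `j ≤ 14` and the parity zeros `j = 16, 18`; `j = 15` is
`sawRows_v00001_getD_15` above; `j = 17` stays displayed). -/
theorem tabsHi_saw_v00001_eq_card (j : ℕ) (hj : j ≤ 16) :
    Stage1Cells.CertD10.tabsHi.saw j .v00001 = ((sawWordsTo 10 j (siteOfList [5] 10)).card : ℚ) := by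
  show (Stage1Cells.CertD10.sawRows .v00001).getD j 0 = _
  interval_cases j
  · exact Stage1Cells.CertD10.sawRows_v00001_getD_0
  · exact Stage1Cells.CertD10.sawRows_v00001_getD_1
  · exact Stage1Cells.CertD10.sawRows_v00001_getD_2
  · exact Stage1Cells.CertD10.sawRows_v00001_getD_3
  · exact Stage1Cells.CertD10.sawRows_v00001_getD_4
  · exact Stage1Cells.CertD10.sawRows_v00001_getD_5
  · exact Stage1Cells.CertD10.sawRows_v00001_getD_6
  · exact Stage1Cells.CertD10.sawRows_v00001_getD_7
  · exact Stage1Cells.CertD10.sawRows_v00001_getD_8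
  · exact Stage1Cells.CertD10.sawRows_v00001_getD_9
  · exact Stage1Cells.CertD10.sawRows_v00001_getD_10
  · exact Stage1Cells.CertD10.sawRows_v00001_getD_11
  · exact Stage1Cells.CertD10.sawRows_v00001_getD_12
  · exact Stage1Cells.CertD10.sawRows_v00001_getD_13
  · exact Stage1Cells.CertD10.sawRows_v00001_getD_14
  · exact sawRows_v00001_getD_15
  · exact Stage1Cells.CertD10.sawRows_v00001_getD_16

end Summit.CriticalPhenomena.LaceExpansionHighD.TabsD10
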